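import Literature.Geometry.Kaehler.RiemannSurfaceEnds
import Literature.Geometry.Kaehler.RiemannSurfaceOnePole
import Mathlib.Geometry.Manifold.MFDeriv.Atlas
import Mathlib.Geometry.Manifold.ContMDiff.Atlas
import Mathlib.Geometry.Manifold.ContMDiff.NormedSpace
import Mathlib.Analysis.Complex.CauchyIntegral
import Mathlib.Analysis.SpecialFunctions.Complex.LogDeriv
import HarnessLib

/-!
# The compactification of the ends of a finite branched covering is a compact Riemann surface

Layer `Literature/Geometry/Kaehler`, continuation of `RiemannSurfaceEnds` (O. Forster, *Lectures on
Riemann Surfaces*, GTM 81 (1981), §8 Thm. 8.4: the COMPLEX STRUCTURE on `X̄ = X ∪ {∞_K}`; §5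
Thm. 5.10: the end charts `ζ_K = w_K⁻¹` are holomorphic). For an `EndsDatum D` on a complex manifold
`T` modelled on `ℂ` whose projection `F` is holomorphic with holomorphic local inverses over
`{R < |z|}` (`EndsDatum.IsHolomorphic`):

* `mdifferentiableAt_of_pow_eq` — **a continuous `e`-th root of a non-vanishing holomorphic
  function is holomorphic** (the holomorphic branch `g(t) exp(log(F/F(t))/e)` and the finiteness of
  the roots of unity); hence `ζ_K|K = w_K⁻¹` is holomorphic (`mdifferentiableOn_endCoordT`) and
  `w_K⁻¹ : {R^{1/e} < |w|} → K` is holomorphic (`mdifferentiableOn_rootInv`: locally the holomorphic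
  local inverse of `F` applied to `w ^ e_K`);
* `instChartedSpace` — the atlas of `T̄`: the charts of `T` transported along `inl`
  (`liftChart`) and the end charts `endChart K`; `chartAt_inl`, `chartAt_infty`;
* `isManifold` — **`T̄` is a complex manifold** (all transition maps are holomorphic on open
  subsets of `ℂ`, `isManifold_of_contDiffOn`);
* `mdifferentiable_inl`, `mdifferentiableOn_inl_symm`, `mdifferentiableAt_comp_inl_iff` —
  `inl` is a local biholomorphism onto its open range.

Everything is proved; the definitions are the predicate, `rootInv`, `inlChart`, `liftChart` and
the `ChartedSpace` instance.

## References

* O. Forster, *Lectures on Riemann Surfaces*, GTM 81, Springer (1981), §8 Thm. 8.4, §5 Thm. 5.10.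
  [Forster1981]
-/

noncomputable section

open scoped Manifold ContDiff Topology
open Set Filter Function Complex
open Literature.Topology.CoveringSpaces

namespace Literature.Geometry.Kaehler

namespace RiemannSurface

/-! ### Continuous roots of holomorphic functions are holomorphic -/

section Root

/-- The `n`-th roots of unity other than `1` form a finite set. [folklore] -/
theorem finite_rootsOfUnity_ne_one (n : ℕ) (hn : 0 < n) : {r : ℂ | r ^ n = 1 ∧ r ≠ 1}.Finite := by
  refine Finite.subset (Polynomial.nthRoots n (1 : ℂ)).toFinset.finite_toSet ?_
  rintro r ⟨hr, -⟩
  simp only [Finset.mem_coe, Multiset.mem_toFinset, Polynomial.mem_nthRoots hn, hr]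

/-- **A function with values in the `n`-th roots of unity near a point, continuous there and equal
to `1` at the point, is `1` near the point** (the other roots of unity form a closed set avoiding
`1`). [folklore] -/
theorem eventually_eq_one_of_pow_eq_one {X : Type*} [TopologicalSpace X] {r : X → ℂ} {n : ℕ} (hn : 0 < n)
    {x : X} (hr : ContinuousAt r x) (h1 : r x = 1) (hpow : ∀ᶠ y in 𝓝 x, r y ^ n = 1) :
    ∀ᶠ y in 𝓝 x, r y = 1 := by
  have hopen : IsOpen {r : ℂ | r ^ n = 1 ∧ r ≠ 1}ᶜ := (finite_rootsOfUnity_ne_one n hn).isClosed.isOpen_compl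
  have hmem : r x ∈ {r : ℂ | r ^ n = 1 ∧ r ≠ 1}ᶜ := by rw [h1]; exact fun h ↦ h.2 rfl
  filter_upwards [hr.preimage_mem_nhds (hopen.mem_nhds hmem), hpow] with y hy hyp
  by_contra hne
  exact hy ⟨hyp, hne⟩

variable {T : Type*} [TopologicalSpace T] [ChartedSpace ℂ T]

/-- **A continuous `n`-th root of a non-vanishing holomorphic function is holomorphic**: if `g` is
continuous at `t`, `F` is holomorphic at `t` with `F(t) ≠ 0`, and `g ^ n = F` near `t` (`n ≥ 1`),
then `g` is holomorphic at `t`. Proof: `ψ = g(t) · exp(log(F/F(t))/n)` is a holomorphic `n`-th root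
of `F` near `t` with `ψ(t) = g(t)`, and `g/ψ` is a continuous root of unity equal to `1` at `t`.
[cite: Forster1981, §5 Thm. 5.10 (proof)] -/
theorem mdifferentiableAt_of_pow_eq {g F : T → ℂ} {n : ℕ} (hn : 0 < n) {t : T} (hg : ContinuousAt g t)
    (hF : MDifferentiableAt 𝓘(ℂ, ℂ) 𝓘(ℂ, ℂ) F t) (hpow : ∀ᶠ s in 𝓝 t, g s ^ n = F s) (h0 : F t ≠ 0) :
    MDifferentiableAt 𝓘(ℂ, ℂ) 𝓘(ℂ, ℂ) g t := by
  set a : ℂ := g t with ha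
  set c : ℂ := F t with hc
  have han : a ^ n = c := hpow.self_of_nhds
  have ha0 : a ≠ 0 := fun h ↦ h0 (by rw [← han, h, zero_pow hn.ne'])
  have hn0 : (n : ℂ) ≠ 0 := Nat.cast_ne_zero.2 hn.ne'
  -- the holomorphic branch `φ(z) = a · exp(log(z/c)/n)`
  set φ : ℂ → ℂ := fun z ↦ a * exp (log (z * c⁻¹) / n) with hφ
  have hφdiff : ∀ z, z * c⁻¹ ∈ slitPlane → DifferentiableAt ℂ φ z := fun z hz ↦
    (differentiableAt_const _).mul (((differentiableAt_id.mul_const _).clog hz).div_const _).cexp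
  have hφpow : ∀ z, z ≠ 0 → φ z ^ n = z := fun z hz ↦ by
    calc φ z ^ n = a ^ n * exp (log (z * c⁻¹) / n) ^ n := mul_pow _ _ _
      _ = a ^ n * exp (log (z * c⁻¹)) := by rw [← exp_nat_mul, mul_div_cancel₀ _ hn0]
      _ = c * (z * c⁻¹) := by rw [han, exp_log (mul_ne_zero hz (inv_ne_zero h0))]
      _ = z := by rw [mul_comm z, ← mul_assoc, mul_inv_cancel₀ h0, one_mul]
  have hφc : φ c = a := by
    simp only [hφ, mul_inv_cancel₀ h0, log_one, zero_div, exp_zero, mul_one]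
  have h1slit : c * c⁻¹ ∈ slitPlane := by rw [mul_inv_cancel₀ h0]; exact one_mem_slitPlane
  -- `ψ = φ ∘ F`
  have hψ : MDifferentiableAt 𝓘(ℂ, ℂ) 𝓘(ℂ, ℂ) (fun s ↦ φ (F s)) t := (hφdiff c h1slit).mdifferentiableAt.comp t hF
  have hψcont : ContinuousAt (fun s ↦ φ (F s)) t := hψ.continuousAt
  have hψt : φ (F t) = a := hφc
  have hFc : ContinuousAt F t := hF.continuousAt
  have hF0 : ∀ᶠ s in 𝓝 t, F s ≠ 0 := hFc.eventually_ne h0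
  -- the ratio `g / ψ` is a continuous root of unity, `1` at `t`
  have hr : ContinuousAt (fun s ↦ g s / φ (F s)) t := hg.div hψcont (by rw [hψt]; exact ha0)
  have hr1 : g t / φ (F t) = 1 := by rw [hψt, ← ha]; exact div_self ha0
  have hrpow : ∀ᶠ s in 𝓝 t, (g s / φ (F s)) ^ n = 1 := by
    filter_upwards [hpow, hF0] with s hs hs0
    rw [div_pow, hs, hφpow (F s) hs0, div_self hs0]
  have hψne : ∀ᶠ s in 𝓝 t, φ (F s) ≠ 0 := hψcont.eventually_ne (by rw [hψt]; exact ha0)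
  have heq : g =ᶠ[𝓝 t] fun s ↦ φ (F s) := by
    filter_upwards [eventually_eq_one_of_pow_eq_one hn hr hr1 hrpow, hψne] with s hs hs0
    rwa [div_eq_one_iff_eq hs0] at hs
  exact hψ.congr_of_eventuallyEq heq

end Root

namespace EndsDatum

variable {T : Type*} [TopologicalSpace T] (D : EndsDatum T)

/-! ### The root and its inverse (topology) -/

open Classical in
/-- The root `w_K` extended to `T` (junk `0` off `K`). [folklore] -/
def rootT (K : D.End) : T → ℂ := fun t ↦ if h : t ∈ (K : Set T) then (K.root ⟨t, h⟩ : ℂ) else 0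

variable {D}

/-- The extended root on the end. [folklore] -/
theorem rootT_of_mem (K : D.End) {t : T} (ht : t ∈ (K : Set T)) : D.rootT K t = K.root ⟨t, ht⟩ := by
  classical
  exact dif_pos ht

/-- `ζ_K = w_K⁻¹` on the end. [folklore] -/
theorem endCoordT_eq_inv (K : D.End) {t : T} (ht : t ∈ (K : Set T)) : D.endCoordT K t = (D.rootT K t)⁻¹ := by
  rw [D.endCoordT_of_mem K ht, rootT_of_mem K ht]

/-- The extended root is continuous on the end. [folklore] -/
theorem continuousOn_rootT (K : D.End) : ContinuousOn (D.rootT K) (K : Set T) := by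
  rw [continuousOn_iff_continuous_restrict]
  have h : Continuous fun k : (K : Set T) ↦ (K.root k : ℂ) := continuous_subtype_val.comp K.root.continuous
  convert h using 1
  funext k
  exact rootT_of_mem K k.2

variable (D) in
open Classical in
/-- **The inverse root `w_K⁻¹ : {R^{1/e_K} < |w|} → K ⊆ T`** (junk off the exterior).
[cite: Forster1981, §5 Thm. 5.10] -/
def rootInv (K : D.End) : ℂ → T := fun w ↦
  if h : w ∈ extDisc (D.R ^ (1 / (K.degree : ℝ))) then (K.root.symm ⟨w, h⟩ : T) else K.pt

/-- The inverse root on the exterior. [folklore] -/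
theorem rootInv_of_mem (K : D.End) {w : ℂ} (hw : w ∈ extDisc (D.R ^ (1 / (K.degree : ℝ)))) :
    D.rootInv K w = (K.root.symm ⟨w, hw⟩ : T) := by
  classical
  exact dif_pos hw

/-- The inverse root takes values in the end. [folklore] -/
theorem rootInv_mem (K : D.End) {w : ℂ} (hw : w ∈ extDisc (D.R ^ (1 / (K.degree : ℝ)))) :
    D.rootInv K w ∈ (K : Set T) := by
  rw [rootInv_of_mem K hw]
  exact (K.root.symm _).2

/-- **`F ∘ w_K⁻¹ = (·) ^ e_K`.** [cite: Forster1981, §5 Thm. 5.10] -/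
theorem F_rootInv (K : D.End) {w : ℂ} (hw : w ∈ extDisc (D.R ^ (1 / (K.degree : ℝ)))) :
    D.F (D.rootInv K w) = w ^ K.degree := by
  rw [rootInv_of_mem K hw, ← K.root_pow, Homeomorph.apply_symm_apply]

/-- The inverse root is continuous on the exterior. [folklore] -/
theorem continuousOn_rootInv (K : D.End) : ContinuousOn (D.rootInv K) (extDisc (D.R ^ (1 / (K.degree : ℝ)))) := by
  rw [continuousOn_iff_continuous_restrict]
  have h : Continuous fun w : extDisc (D.R ^ (1 / (K.degree : ℝ))) ↦ (K.root.symm w : T) :=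
    continuous_subtype_val.comp K.root.symm.continuous
  convert h using 1
  funext w
  exact rootInv_of_mem K w.2

/-- The inverse end coordinate through the inverse root: `ζ_K⁻¹(z) = inl (w_K⁻¹ (z⁻¹))`. [folklore] -/
theorem endCoordInv_eq_inl_rootInv (K : D.End) {z : ℂ} (hz : z ≠ 0) (hzρ : ‖z‖ < K.rho) :
    D.endCoordInv K z = D.inl (D.rootInv K z⁻¹) := by
  rw [D.endCoordInv_of_ne K hz hzρ, rootInv_of_mem K (K.inv_mem_extDisc hz hzρ)]

variable (D) in
/-- Distinct ends have disjoint cusp neighbourhoods. [folklore] -/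
theorem disjoint_cuspNhd {K K' : D.End} (h : K ≠ K') (r r' : ℝ) : Disjoint (D.cuspNhd K r) (D.cuspNhd K' r') := by
  refine disjoint_left.2 fun z hz hz' ↦ ?_
  rcases D.inl_or_infty z with ⟨s, rfl⟩ | ⟨K'', rfl⟩
  · rw [inl_mem_cuspNhd_iff] at hz hz'
    exact h (End.eq_of_mem hz.1 hz'.1)
  · rw [infty_mem_cuspNhd_iff] at hz hz'
    exact h (hz.symm.trans hz')

/-! ### The atlas of the compactification -/

section Inl

variable (D) [Nonempty T]

/-- `inl` as an open partial homeomorphism `T ≃ range inl`. [folklore] -/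
def inlChart : OpenPartialHomeomorph T D.Cpt := D.isOpenEmbedding_inl.toOpenPartialHomeomorph D.inl

/-- `inlChart` is `inl` (definitional up to Mathlib's `simps`). [folklore] -/
@[simp] theorem inlChart_apply : ⇑D.inlChart = D.inl := D.isOpenEmbedding_inl.toOpenPartialHomeomorph_apply _

/-- The source of `inlChart` is everything. [folklore] -/
@[simp] theorem inlChart_source : D.inlChart.source = univ := D.isOpenEmbedding_inl.toOpenPartialHomeomorph_source _

/-- The target of `inlChart` is the range of `inl`. [folklore] -/
@[simp] theorem inlChart_target : D.inlChart.target = range D.inl := D.isOpenEmbedding_inl.toOpenPartialHomeomorph_target _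

/-- `inlChart.symm ∘ inl = id`. [folklore] -/
@[simp] theorem inlChart_symm_inl (t : T) : D.inlChart.symm (D.inl t) = t :=
  D.isOpenEmbedding_inl.toOpenPartialHomeomorph_left_inv

/-- `inl ∘ inlChart.symm = id` on the range. [folklore] -/
theorem inl_inlChart_symm {x : D.Cpt} (hx : x ∈ range D.inl) : D.inl (D.inlChart.symm x) = x :=
  Topology.IsOpenEmbedding.toOpenPartialHomeomorph_right_inv (f := D.inl) (h := D.isOpenEmbedding_inl) hx

end Inl

/-- **New–new transitions**: identity (same end) or empty (distinct ends). [folklore] -/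
theorem differentiableOn_endChart_endChart (K K' : D.End) :
    DifferentiableOn ℂ ((D.endChart K).symm.trans (D.endChart K')) ((D.endChart K).symm.trans (D.endChart K')).source := by
  by_cases hKK : K = K'
  · subst hKK
    refine differentiableOn_id.congr fun z hz ↦ ?_
    rw [OpenPartialHomeomorph.trans_source, OpenPartialHomeomorph.symm_source] at hz
    exact (D.endChart K).right_inv hz.1
  · have hempty : ((D.endChart K).symm.trans (D.endChart K')).source = ∅ := by
      refine eq_empty_of_forall_notMem fun z hz ↦ ?_
      rw [OpenPartialHomeomorph.trans_source, OpenPartialHomeomorph.symm_source] at hz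
      have h1 : (D.endChart K).symm z ∈ (D.endChart K).source := (D.endChart K).map_target hz.1
      have h2 : (D.endChart K).symm z ∈ (D.endChart K').source := hz.2
      rw [endChart_source] at h1 h2
      exact disjoint_left.1 (D.disjoint_cuspNhd hKK 0 0) h1 h2
    rw [hempty]
    exact differentiableOn_empty

variable [ChartedSpace ℂ T]

/-! ### Holomorphic ends data -/

/-- **The projection is holomorphic with holomorphic local inverses over the exterior**: `F` is
holomorphic, and every point over `{R < |z|}` has a local homeomorphism piece of `F` whose inverse is
holomorphic (e.g. `F` étale there). [cite: Forster1981, §8 Thm. 8.4] -/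
structure IsHolomorphic : Prop where
  /-- `F` is holomorphic -/
  mdifferentiable : MDifferentiable 𝓘(ℂ, ℂ) 𝓘(ℂ, ℂ) D.F
  /-- `F` has holomorphic local inverses over the exterior of the disc -/
  localInverse : ∀ t ∈ D.total, ∃ e : OpenPartialHomeomorph T ℂ, t ∈ e.source ∧ ⇑e = D.F ∧
    MDifferentiableOn 𝓘(ℂ, ℂ) 𝓘(ℂ, ℂ) e.symm e.target

section Atlas

variable (D) [Nonempty T]

/-- **The chart of `T̄` at an old point**: the chart of `T` transported along `inl`. [cite: Forster1981, §8 Thm. 8.4 (proof)] -/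
def liftChart (t : T) : OpenPartialHomeomorph D.Cpt ℂ := D.inlChart.symm.trans (chartAt ℂ t)

/-- The lifted chart as a function. [folklore] -/
theorem liftChart_apply (t : T) (x : D.Cpt) : D.liftChart t x = chartAt ℂ t (D.inlChart.symm x) := rfl

/-- The lifted chart at an old point. [folklore] -/
@[simp] theorem liftChart_inl (t s : T) : D.liftChart t (D.inl s) = chartAt ℂ t s := by
  rw [liftChart_apply, inlChart_symm_inl]

/-- The inverse of the lifted chart. [folklore] -/
@[simp] theorem liftChart_symm_apply (t : T) (z : ℂ) : (D.liftChart t).symm z = D.inl ((chartAt ℂ t).symm z) := by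
  change D.inlChart.symm.symm ((chartAt ℂ t).symm z) = _
  rw [OpenPartialHomeomorph.symm_symm, inlChart_apply]

/-- The source of the lifted chart. [folklore] -/
theorem liftChart_source (t : T) : (D.liftChart t).source = D.inl '' (chartAt ℂ t).source := by
  rw [liftChart, OpenPartialHomeomorph.trans_source, OpenPartialHomeomorph.symm_source, inlChart_target]
  ext x
  constructor
  · rintro ⟨⟨s, rfl⟩, hx⟩
    rw [mem_preimage, inlChart_symm_inl] at hx
    exact ⟨s, hx, rfl⟩
  · rintro ⟨s, hs, rfl⟩
    exact ⟨⟨s, rfl⟩, by rw [mem_preimage, inlChart_symm_inl]; exact hs⟩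

/-- Membership of an old point in the source of a lifted chart. [folklore] -/
@[simp] theorem inl_mem_liftChart_source {t s : T} : D.inl s ∈ (D.liftChart t).source ↔ s ∈ (chartAt ℂ t).source := by
  rw [liftChart_source, D.inl_injective.mem_set_image]

/-- The source of a lifted chart lies in the range of `inl`. [folklore] -/
theorem liftChart_source_subset (t : T) : (D.liftChart t).source ⊆ range D.inl := by
  rw [liftChart_source]
  rintro _ ⟨s, -, rfl⟩
  exact ⟨s, rfl⟩

/-- The target of the lifted chart. [folklore] -/
@[simp] theorem liftChart_target (t : T) : (D.liftChart t).target = (chartAt ℂ t).target := by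
  rw [liftChart, OpenPartialHomeomorph.trans_target, OpenPartialHomeomorph.symm_target, inlChart_source, preimage_univ,
    inter_univ]

/-- **The atlas of `T̄`**: lifted charts at the old points, end charts at the new ones.
[cite: Forster1981, §8 Thm. 8.4 (proof)] -/
instance instChartedSpace : ChartedSpace ℂ D.Cpt where
  atlas := range D.liftChart ∪ range D.endChart
  chartAt := Sum.elim (fun t ↦ D.liftChart t) fun K ↦ D.endChart K
  mem_chart_source x := by
    rcases D.inl_or_infty x with ⟨t, rfl⟩ | ⟨K, rfl⟩
    · change D.inl t ∈ (D.liftChart t).source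
      rw [inl_mem_liftChart_source]
      exact mem_chart_source ℂ t
    · exact D.infty_mem_endChart_source K
  chart_mem_atlas x := by
    rcases D.inl_or_infty x with ⟨t, rfl⟩ | ⟨K, rfl⟩
    · exact Or.inl ⟨t, rfl⟩
    · exact Or.inr ⟨K, rfl⟩

/-- The chart at an old point (definitional). [folklore] -/
@[simp] theorem chartAt_inl (t : T) : chartAt ℂ (D.inl t) = D.liftChart t := rfl

/-- The chart at a new point (definitional). [folklore] -/
@[simp] theorem chartAt_infty (K : D.End) : chartAt ℂ (D.infty K) = D.endChart K := rfl

/-- The centred chart coordinate of `T̄` at `∞_K` is the end coordinate `ζ_K`. [folklore] -/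
theorem coord_infty (K : D.End) (x : D.Cpt) : coord (D.infty K) x = D.endCoord K x := by
  rw [coord, chartAt_infty, coe_endChart, endCoord_infty, sub_zero]

end Atlas

/-! ### The root and its inverse are holomorphic -/

section Hol

/-- **The inverse root is holomorphic** (locally it is the holomorphic local inverse of `F` applied
to `w ^ e_K`). [cite: Forster1981, §5 Thm. 5.10] -/
theorem IsHolomorphic.mdifferentiableOn_rootInv (h : D.IsHolomorphic) (K : D.End) :
    MDifferentiableOn 𝓘(ℂ, ℂ) 𝓘(ℂ, ℂ) (D.rootInv K) (extDisc (D.R ^ (1 / (K.degree : ℝ)))) := by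
  intro w hw
  have ht : D.rootInv K w ∈ D.total := K.subset_total (rootInv_mem K hw)
  obtain ⟨e, hte, heF, hesymm⟩ := h.localInverse _ ht
  have hopen : IsOpen (extDisc (D.R ^ (1 / (K.degree : ℝ)))) := isOpen_extDisc _
  -- near `w`, `rootInv` stays in the source of the piece
  have hev : ∀ᶠ w' in 𝓝 w, w' ∈ extDisc (D.R ^ (1 / (K.degree : ℝ))) ∧ D.rootInv K w' ∈ e.source := by
    have h1 : ∀ᶠ w' in 𝓝 w, w' ∈ extDisc (D.R ^ (1 / (K.degree : ℝ))) := hopen.mem_nhds hw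
    have h2 : ∀ᶠ w' in 𝓝 w, D.rootInv K w' ∈ e.source :=
      ((continuousOn_rootInv K).continuousAt (hopen.mem_nhds hw)).preimage_mem_nhds (e.open_source.mem_nhds hte)
    exact h1.and h2
  -- there `rootInv w' = e.symm (w' ^ e_K)`
  have heq : D.rootInv K =ᶠ[𝓝 w] fun w' ↦ e.symm (w' ^ K.degree) := by
    filter_upwards [hev] with w' hw'
    have h1 := e.left_inv hw'.2
    rw [heF, F_rootInv K hw'.1] at h1
    exact h1.symm
  have htarget : w ^ K.degree ∈ e.target := by
    rw [← F_rootInv K hw, ← heF]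
    exact e.map_source hte
  have h2 : MDifferentiableAt 𝓘(ℂ, ℂ) 𝓘(ℂ, ℂ) (fun w' ↦ e.symm (w' ^ K.degree)) w :=
    ((hesymm _ htarget).mdifferentiableAt (e.open_target.mem_nhds htarget)).comp w
      (differentiableAt_pow (𝕜 := ℂ) K.degree).mdifferentiableAt
  exact (h2.congr_of_eventuallyEq heq).mdifferentiableWithinAt

/-- **The root `w_K` is holomorphic on the end** (a continuous `e_K`-th root of `F`).
[cite: Forster1981, §5 Thm. 5.10] -/
theorem IsHolomorphic.mdifferentiableOn_rootT (h : D.IsHolomorphic) (K : D.End) :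
    MDifferentiableOn 𝓘(ℂ, ℂ) 𝓘(ℂ, ℂ) (D.rootT K) (K : Set T) := by
  intro t ht
  refine (mdifferentiableAt_of_pow_eq K.degree_pos ((continuousOn_rootT K).continuousAt (K.isOpen.mem_nhds ht))
    (h.mdifferentiable t) ?_ ?_).mdifferentiableWithinAt
  · filter_upwards [K.isOpen.mem_nhds ht] with s hs
    rw [rootT_of_mem K hs, K.root_pow ⟨s, hs⟩]
  · exact ne_zero_of_mem_extDisc D.R_pos (K.subset_total ht)

/-- **The end coordinate `ζ_K` is holomorphic on the end.** [cite: Forster1981, §5 Thm. 5.10] -/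
theorem IsHolomorphic.mdifferentiableOn_endCoordT (h : D.IsHolomorphic) (K : D.End) :
    MDifferentiableOn 𝓘(ℂ, ℂ) 𝓘(ℂ, ℂ) (D.endCoordT K) (K : Set T) := by
  intro t ht
  have hr : MDifferentiableAt 𝓘(ℂ, ℂ) 𝓘(ℂ, ℂ) (D.rootT K) t :=
    (h.mdifferentiableOn_rootT K t ht).mdifferentiableAt (K.isOpen.mem_nhds ht)
  have hr0 : D.rootT K t ≠ 0 := by rw [rootT_of_mem K ht]; exact K.root_ne_zero _
  have hinv : MDifferentiableAt 𝓘(ℂ, ℂ) 𝓘(ℂ, ℂ) (fun s ↦ (D.rootT K s)⁻¹) t :=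
    (differentiableAt_inv hr0).mdifferentiableAt.comp t hr
  refine (hinv.congr_of_eventuallyEq ?_).mdifferentiableWithinAt
  filter_upwards [K.isOpen.mem_nhds ht] with s hs
  exact endCoordT_eq_inv K hs

end Hol

section Manifold

variable [IsManifold 𝓘(ℂ, ℂ) ω T] [Nonempty T]

/-! ### The transition maps are holomorphic -/

/-- **Old–old transitions**: `liftChart t' ∘ (liftChart t)⁻¹ = chart t' ∘ (chart t)⁻¹` is holomorphic.
[cite: Forster1981, §8 Thm. 8.4 (proof)] -/
theorem differentiableOn_liftChart_liftChart (t t' : T) :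
    DifferentiableOn ℂ ((D.liftChart t).symm.trans (D.liftChart t')) ((D.liftChart t).symm.trans (D.liftChart t')).source := by
  have hsrc : ((D.liftChart t).symm.trans (D.liftChart t')).source = ((chartAt ℂ t).symm.trans (chartAt ℂ t')).source := by
    ext z
    simp only [OpenPartialHomeomorph.trans_source, OpenPartialHomeomorph.symm_source, liftChart_target, mem_inter_iff,
      mem_preimage, liftChart_symm_apply, inl_mem_liftChart_source]
  have hT : MDifferentiableOn 𝓘(ℂ, ℂ) 𝓘(ℂ, ℂ) ((chartAt ℂ t).symm.trans (chartAt ℂ t')) ((chartAt ℂ t).symm.trans (chartAt ℂ t')).source := by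
    intro z hz
    rw [OpenPartialHomeomorph.trans_source, OpenPartialHomeomorph.symm_source] at hz
    exact ((mdifferentiableAt_atlas (I := 𝓘(ℂ, ℂ)) (chart_mem_atlas ℂ t') hz.2).comp z
      (mdifferentiableAt_atlas_symm (I := 𝓘(ℂ, ℂ)) (chart_mem_atlas ℂ t) hz.1)).mdifferentiableWithinAt
  rw [hsrc]
  refine (mdifferentiableOn_iff_differentiableOn.1 hT).congr fun z hz ↦ ?_
  change D.liftChart t' ((D.liftChart t).symm z) = chartAt ℂ t' ((chartAt ℂ t).symm z)
  rw [liftChart_symm_apply, liftChart_inl]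

/-- **Old–new transitions**: `ζ_K ∘ (liftChart t)⁻¹ = ζ_K|K ∘ (chart t)⁻¹` is holomorphic.
[cite: Forster1981, §8 Thm. 8.4 (proof)] -/
theorem IsHolomorphic.differentiableOn_liftChart_endChart (h : D.IsHolomorphic) (t : T) (K : D.End) :
    DifferentiableOn ℂ ((D.liftChart t).symm.trans (D.endChart K)) ((D.liftChart t).symm.trans (D.endChart K)).source := by
  have hsrc : ∀ z ∈ ((D.liftChart t).symm.trans (D.endChart K)).source,
      z ∈ (chartAt ℂ t).target ∧ (chartAt ℂ t).symm z ∈ (K : Set T) := fun z hz ↦ by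
    simp only [OpenPartialHomeomorph.trans_source, OpenPartialHomeomorph.symm_source, liftChart_target, mem_inter_iff,
      mem_preimage, liftChart_symm_apply, endChart_source, inl_mem_cuspNhd_iff] at hz
    exact ⟨hz.1, hz.2.1⟩
  have hM : MDifferentiableOn 𝓘(ℂ, ℂ) 𝓘(ℂ, ℂ) (fun z ↦ D.endCoordT K ((chartAt ℂ t).symm z))
      ((D.liftChart t).symm.trans (D.endChart K)).source := fun z hz ↦
    (((h.mdifferentiableOn_endCoordT K _ (hsrc z hz).2).mdifferentiableAt (K.isOpen.mem_nhds (hsrc z hz).2)).comp z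
      (mdifferentiableAt_atlas_symm (I := 𝓘(ℂ, ℂ)) (chart_mem_atlas ℂ t) (hsrc z hz).1)).mdifferentiableWithinAt
  refine (mdifferentiableOn_iff_differentiableOn.1 hM).congr fun z _ ↦ ?_
  change D.endChart K ((D.liftChart t).symm z) = D.endCoordT K ((chartAt ℂ t).symm z)
  rw [liftChart_symm_apply, coe_endChart, endCoord_inl]

/-- **New–old transitions**: `liftChart t ∘ ζ_K⁻¹ = chart t ∘ w_K⁻¹ ∘ (·)⁻¹` is holomorphic.
[cite: Forster1981, §8 Thm. 8.4 (proof)] -/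
theorem IsHolomorphic.differentiableOn_endChart_liftChart (h : D.IsHolomorphic) (K : D.End) (t : T) :
    DifferentiableOn ℂ ((D.endChart K).symm.trans (D.liftChart t)) ((D.endChart K).symm.trans (D.liftChart t)).source := by
  have hsrc : ∀ z ∈ ((D.endChart K).symm.trans (D.liftChart t)).source,
      z ≠ 0 ∧ ‖z‖ < K.rho ∧ D.rootInv K z⁻¹ ∈ (chartAt ℂ t).source := fun z hz ↦ by
    simp only [OpenPartialHomeomorph.trans_source, OpenPartialHomeomorph.symm_source, endChart_target, mem_inter_iff,
      Metric.mem_ball, dist_zero_right, mem_preimage, coe_endChart_symm] at hz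
    have hz0 : z ≠ 0 := by
      rintro rfl
      have h0 := D.liftChart_source_subset t hz.2
      rw [endCoordInv_zero] at h0
      obtain ⟨s, hs⟩ := h0
      exact D.inl_ne_infty s K hs
    refine ⟨hz0, hz.1, ?_⟩
    have h2 := hz.2
    rwa [endCoordInv_eq_inl_rootInv K hz0 hz.1, inl_mem_liftChart_source] at h2
  have hM : MDifferentiableOn 𝓘(ℂ, ℂ) 𝓘(ℂ, ℂ) (fun z ↦ chartAt ℂ t (D.rootInv K z⁻¹))
      ((D.endChart K).symm.trans (D.liftChart t)).source := fun z hz ↦ by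
    obtain ⟨hz0, hzρ, hsrc'⟩ := hsrc z hz
    have hmem : z⁻¹ ∈ extDisc (D.R ^ (1 / (K.degree : ℝ))) := K.inv_mem_extDisc hz0 hzρ
    have h1 : MDifferentiableAt 𝓘(ℂ, ℂ) 𝓘(ℂ, ℂ) (fun z : ℂ ↦ z⁻¹) z := (differentiableAt_inv hz0).mdifferentiableAt
    have h2 : MDifferentiableAt 𝓘(ℂ, ℂ) 𝓘(ℂ, ℂ) (D.rootInv K) z⁻¹ :=
      (h.mdifferentiableOn_rootInv K _ hmem).mdifferentiableAt ((isOpen_extDisc _).mem_nhds hmem)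
    have h3 : MDifferentiableAt 𝓘(ℂ, ℂ) 𝓘(ℂ, ℂ) (chartAt ℂ t) (D.rootInv K z⁻¹) :=
      mdifferentiableAt_atlas (I := 𝓘(ℂ, ℂ)) (chart_mem_atlas ℂ t) hsrc'
    exact (h3.comp z (h2.comp z h1)).mdifferentiableWithinAt
  refine (mdifferentiableOn_iff_differentiableOn.1 hM).congr fun z hz ↦ ?_
  obtain ⟨hz0, hzρ, -⟩ := hsrc z hz
  change D.liftChart t ((D.endChart K).symm z) = chartAt ℂ t (D.rootInv K z⁻¹)
  rw [coe_endChart_symm, endCoordInv_eq_inl_rootInv K hz0 hzρ, liftChart_inl]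

/-- **`T̄` is a complex manifold.** [cite: Forster1981, §8 Thm. 8.4] -/
theorem isManifold (h : D.IsHolomorphic) : IsManifold 𝓘(ℂ, ℂ) ω D.Cpt := by
  refine isManifold_of_contDiffOn _ _ _ ?_
  rintro e e' (⟨t, rfl⟩ | ⟨K, rfl⟩) (⟨t', rfl⟩ | ⟨K', rfl⟩) <;>
    simp only [modelWithCornersSelf_coe, modelWithCornersSelf_coe_symm, range_id, inter_univ, preimage_id_eq, id_eq,
      CompTriple.comp_eq]
  · exact (differentiableOn_liftChart_liftChart t t').contDiffOn ((D.liftChart t).symm.trans (D.liftChart t')).open_source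
  · exact (h.differentiableOn_liftChart_endChart t K').contDiffOn ((D.liftChart t).symm.trans (D.endChart K')).open_source
  · exact (h.differentiableOn_endChart_liftChart K t').contDiffOn ((D.endChart K).symm.trans (D.liftChart t')).open_source
  · exact (differentiableOn_endChart_endChart K K').contDiffOn ((D.endChart K).symm.trans (D.endChart K')).open_source

/-! ### `inl` is a local biholomorphism onto its range -/

/-- **`inl` is holomorphic.** [folklore] -/
theorem IsHolomorphic.mdifferentiable_inl (h : D.IsHolomorphic) : MDifferentiable 𝓘(ℂ, ℂ) 𝓘(ℂ, ℂ) D.inl := by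
  haveI := isManifold h
  intro t
  have h1 : MDifferentiableAt 𝓘(ℂ, ℂ) 𝓘(ℂ, ℂ) (fun s ↦ (D.liftChart t).symm (chartAt ℂ t s)) t :=
    (mdifferentiableAt_atlas_symm (I := 𝓘(ℂ, ℂ)) (chart_mem_atlas ℂ (D.inl t))
      (by rw [chartAt_inl, liftChart_target]; exact (chartAt ℂ t).map_source (mem_chart_source ℂ t))).comp t
      (mdifferentiableAt_atlas (I := 𝓘(ℂ, ℂ)) (chart_mem_atlas ℂ t) (mem_chart_source ℂ t))
  refine h1.congr_of_eventuallyEq ?_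
  filter_upwards [(chartAt ℂ t).open_source.mem_nhds (mem_chart_source ℂ t)] with s hs
  rw [liftChart_symm_apply, (chartAt ℂ t).left_inv hs]

/-- **The inverse of `inl` is holomorphic on the range.** [folklore] -/
theorem IsHolomorphic.mdifferentiableOn_inlChart_symm (h : D.IsHolomorphic) :
    MDifferentiableOn 𝓘(ℂ, ℂ) 𝓘(ℂ, ℂ) D.inlChart.symm (range D.inl) := by
  haveI := isManifold h
  rintro _ ⟨t, rfl⟩
  have h1 : MDifferentiableAt 𝓘(ℂ, ℂ) 𝓘(ℂ, ℂ) (fun x ↦ (chartAt ℂ t).symm (D.liftChart t x)) (D.inl t) :=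
    (mdifferentiableAt_atlas_symm (I := 𝓘(ℂ, ℂ)) (chart_mem_atlas ℂ t)
      (by rw [liftChart_inl]; exact (chartAt ℂ t).map_source (mem_chart_source ℂ t))).comp (D.inl t)
      (mdifferentiableAt_atlas (I := 𝓘(ℂ, ℂ)) (chart_mem_atlas ℂ (D.inl t))
        (by rw [chartAt_inl, inl_mem_liftChart_source]; exact mem_chart_source ℂ t))
  refine (h1.congr_of_eventuallyEq ?_).mdifferentiableWithinAt
  have hopen : IsOpen (D.liftChart t).source := (D.liftChart t).open_source
  filter_upwards [hopen.mem_nhds (by rw [inl_mem_liftChart_source]; exact mem_chart_source ℂ t)] with x hx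
  rw [liftChart_source] at hx
  obtain ⟨s, hs, rfl⟩ := hx
  rw [inlChart_symm_inl, liftChart_inl, (chartAt ℂ t).left_inv hs]

/-- **Holomorphy at an old point is holomorphy of the composite with `inl`.** [folklore] -/
theorem IsHolomorphic.mdifferentiableAt_comp_inl_iff (h : D.IsHolomorphic) {g : D.Cpt → ℂ} {t : T} :
    MDifferentiableAt 𝓘(ℂ, ℂ) 𝓘(ℂ, ℂ) (fun s ↦ g (D.inl s)) t ↔ MDifferentiableAt 𝓘(ℂ, ℂ) 𝓘(ℂ, ℂ) g (D.inl t) := by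
  haveI := isManifold h
  constructor
  · intro hg
    have h1 : MDifferentiableAt 𝓘(ℂ, ℂ) 𝓘(ℂ, ℂ) (fun x ↦ g (D.inl (D.inlChart.symm x))) (D.inl t) := by
      have hs : MDifferentiableAt 𝓘(ℂ, ℂ) 𝓘(ℂ, ℂ) D.inlChart.symm (D.inl t) :=
        (h.mdifferentiableOn_inlChart_symm _ ⟨t, rfl⟩).mdifferentiableAt (D.isOpen_range_inl.mem_nhds ⟨t, rfl⟩)
      rw [← inlChart_symm_inl (D := D) t] at hg
      exact hg.comp (D.inl t) hs
    refine h1.congr_of_eventuallyEq ?_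
    filter_upwards [D.isOpen_range_inl.mem_nhds ⟨t, rfl⟩] with x hx
    rw [inl_inlChart_symm _ hx]
  · intro hg
    exact hg.comp t (h.mdifferentiable_inl t)

end Manifold

end EndsDatum

end RiemannSurface

end Literature.Geometry.Kaehler
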